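import Summits.ResolutionOfSingularities.ResolutionOfSingularities.Theorems.MarkedTransferCampaignW46UselessProcrastination
import HarnessLib

/-!
# [OURS · L1 W4.6 rung (i-i)] THE BUDGET OF GOOD PROCRASTINATIONS: along any §2.1-permissible surface sequence the number of
# good procrastinations is at most the total `δ`-invariant `Δ(E₀) < ∞` of the prime divisors of `V(J₀)` (cell res-hironaka,
# LADDER-RESOLUTION rung L, D-0089; campaign s46, prover res-L1-s46-pv-1; host route MarkedTransfer,
# `--supports stmt-ResolutionOfSingularities-16155`)

HONEST FRAMING. Nothing here is a statement of H. Hironaka's manuscript (2017-03-23, [Hironaka2017]) and nothing here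
asserts that any statement of it holds. OURS bookkeeping over rung (i-i)'s monotonicity of `Δ`
(`exists_hasCurveFamily_transform_le` / `_lt`). AI-written; weaker than expert review. No `sorry`; axioms standard.

## What (numbers, not adjectives)

For a §2.1-permissible sequence `r` all of whose stages are surface states (ANY field `K`, any universe) and a curve
family of `V(J₀)` at stage `0` of total `δ`-invariant `Δ₀`:

* `HasCurveFamily.ne_top` — `Δ₀ < ∞`;
* `PermissibleRun.exists_hasCurveFamily_budget` — at every stage `N` there is a curve family of total `δ`-invariant `Δ_N`
  with `Δ_N + #{k < N | step k is a good procrastination} ≤ Δ₀`;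
* **`PermissibleRun.card_goodProcrastinations_le`** — every finite set of stages at which `r` makes a GOOD
  procrastination has at most `Δ₀` elements. So PHASE 0 of OUR procedure takes at most `Δ(E₀)` steps, whatever the
  choices, and in ANY permissible surface sequence only `Δ(E₀)` steps can be good procrastinations.

## References

* J. Kollár, Lectures on Resolution of Singularities (2007), §1.4 («blowing up singular points of a curve terminates
  after at most `δ(C)` steps»). [Kollar2007]
* H. Hironaka, ms. 2017-03-23, Th. 16.13 p.87 l.26–28 — scope only, under adjudication, not cited as fact. [Hironaka2017]
-/

noncomputable section

set_option linter.dupNamespace false -- mandated namespace of this single-conjunct summit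

open CategoryTheory AlgebraicGeometry TopologicalSpace

namespace Summit.ResolutionOfSingularities.ResolutionOfSingularities.Theorems

namespace CampaignW46

open Literature.AlgebraicGeometry.Resolution
open Literature.AlgebraicGeometry.Hironaka2017.S02Preliminaries
open Literature.AlgebraicGeometry.Hironaka2017.Datum
open Scheme.IdealSheafData

universe u

variable {p : ℕ} [Fact p.Prime] {K : Type u} [Field K] [CharP K p]

/-- **`Δ < ∞`**: the total `δ`-invariant of a curve family is finite (each member is a Noetherian quasi-excellent curve,
`finsum_pointDelta_ne_top`). [cite: Kollar2007, §1.4] -/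
theorem HasCurveFamily.ne_top {Z : Scheme.{u}} {J : Z.IdealSheafData} {n : ℕ∞} (h : HasCurveFamily Z J n) : n ≠ ⊤ := by
  classical
  obtain ⟨ι, hι, ζ, C, i, hfam, -, -, hn⟩ := h
  haveI : ∀ k, IsIntegral (C k) := fun k => (hfam k).2.1
  haveI : ∀ k, IsNoetherian (C k) := fun k => (hfam k).2.2.1
  haveI := Fintype.ofFinite ι
  rw [← hn, familyDelta_def, finsum_eq_sum_of_fintype]
  exact ENat.sum_ne_top.mpr fun k _ => finsum_pointDelta_ne_top (hfam k).2.2.2.1 (hfam k).2.2.2.2.1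

namespace PermissibleRun

/-- **The budget invariant**: at stage `N` a curve family of total `δ`-invariant `Δ_N` with
`Δ_N + #{k < N | good procrastination at k} ≤ Δ₀`. [cite: Kollar2007, §1.4] -/
theorem exists_hasCurveFamily_budget (r : PermissibleRun p K) (hdim : ∀ k, Regime.dimLE 2 (r.A k) (r.E k))
    {n₀ : ℕ∞} (hF₀ : HasCurveFamily (r.A 0).Z (r.E 0).J n₀) (s : Finset ℕ)
    (hs : ∀ k ∈ s, CentreGoodProcrastination (r.E k) (r.D k)) (N : ℕ) :
    ∃ n, HasCurveFamily (r.A N).Z (r.E N).J n ∧ n + ((s.filter (· < N)).card : ℕ∞) ≤ n₀ := by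
  induction N with
  | zero =>
    refine ⟨n₀, hF₀, ?_⟩
    have h0 : s.filter (· < 0) = ∅ := Finset.filter_false_of_mem fun k _ => Nat.not_lt_zero k
    rw [h0, Finset.card_empty, Nat.cast_zero, add_zero]
  | succ N ih =>
    obtain ⟨n, hF, hle⟩ := ih
    have hsplit : s.filter (· < N + 1) = s.filter (· < N) ∪ s.filter (· = N) := by
      ext k
      simp only [Finset.mem_filter, Finset.mem_union]
      constructor
      · rintro ⟨hk, hlt⟩
        rcases Nat.lt_succ_iff_lt_or_eq.mp hlt with h | h
        · exact Or.inl ⟨hk, h⟩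
        · exact Or.inr ⟨hk, h⟩
      · rintro (⟨hk, h⟩ | ⟨hk, h⟩)
        · exact ⟨hk, Nat.lt_succ_of_lt h⟩
        · exact ⟨hk, h ▸ Nat.lt_succ_self N⟩
    have hdisj : Disjoint (s.filter (· < N)) (s.filter (· = N)) := by
      rw [Finset.disjoint_filter]
      intro k _ hlt heq
      exact absurd heq (Nat.ne_of_lt hlt)
    by_cases hN : N ∈ s
    · -- a good procrastination at `N`: `Δ` drops by at least one
      obtain ⟨n', hlt, hF'⟩ := exists_hasCurveFamily_transform_lt (r.A N) (r.A (N + 1)) (r.E N) (r.standard N)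
        (hdim N) (hs N hN) (r.blowup N) hF
      rw [← r.E_succ N] at hF'
      refine ⟨n', hF', ?_⟩
      have hone : s.filter (· = N) = {N} := by
        ext k
        simp only [Finset.mem_filter, Finset.mem_singleton]
        exact ⟨fun h => h.2, fun h => ⟨h ▸ hN, h⟩⟩
      rw [hsplit, Finset.card_union_of_disjoint hdisj, hone, Finset.card_singleton, Nat.cast_add, Nat.cast_one,
        ← add_assoc, add_right_comm]
      exact le_trans (add_le_add (Order.add_one_le_of_lt hlt) le_rfl) hle
    · -- any other permissible step: `Δ` does not go up
      obtain ⟨n', hle', hF'⟩ := exists_hasCurveFamily_transform_le (r.A N) (r.A (N + 1)) (r.E N) (r.standard N)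
        (hdim N) (r.permissible N) (r.blowup N) hF
      rw [← r.E_succ N] at hF'
      refine ⟨n', hF', ?_⟩
      have hnone : s.filter (· = N) = ∅ := Finset.filter_false_of_mem fun k hk h => hN (h ▸ hk)
      rw [hsplit, hnone, Finset.union_empty]
      exact le_trans (add_le_add hle' le_rfl) hle

/-- [OURS · L1 W4.6 rung (i-i)] NOT a statement of the manuscript. **THE BUDGET OF GOOD PROCRASTINATIONS.** Along a
§2.1-permissible sequence all of whose stages have dimension `≤ 2` (any field), every finite set of stages at which the
centre is a GOOD procrastination has at most `Δ₀` elements, `Δ₀ < ∞` the total `δ`-invariant of any curve family of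
`V(J₀)` at stage `0` (`exists_hasCurveFamily`, `HasCurveFamily.ne_top`): `Δ` never increases along permissible surface
steps and drops at each good procrastination. [cite: Kollar2007, §1.4] -/
theorem card_goodProcrastinations_le (r : PermissibleRun p K) (hdim : ∀ k, Regime.dimLE 2 (r.A k) (r.E k))
    {n₀ : ℕ∞} (hF₀ : HasCurveFamily (r.A 0).Z (r.E 0).J n₀) (s : Finset ℕ)
    (hs : ∀ k ∈ s, CentreGoodProcrastination (r.E k) (r.D k)) : (s.card : ℕ∞) ≤ n₀ := by
  -- beyond `N = sup s + 1` the filter is all of `s`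
  obtain ⟨n, -, hle⟩ := r.exists_hasCurveFamily_budget hdim hF₀ s hs (s.sup id + 1)
  have hall : s.filter (· < s.sup id + 1) = s := by
    refine Finset.filter_true_of_mem fun k hk => Nat.lt_succ_of_le ?_
    exact Finset.le_sup (f := id) hk
  rw [hall] at hle
  exact le_trans le_add_self hle

/-- [OURS · L1 W4.6 rung (i-i)] NOT a statement of the manuscript. **Hence, from a standard surface state, a finite
budget**: for every §2.1-permissible surface sequence there is a natural number `B` (the total `δ`-invariant of the prime
divisors of `V(J₀)`) bounding the size of every finite set of good-procrastination stages. [cite: Kollar2007, §1.4] -/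
theorem exists_goodProcrastination_budget (r : PermissibleRun p K) (hdim : ∀ k, Regime.dimLE 2 (r.A k) (r.E k)) :
    ∃ B : ℕ, ∀ s : Finset ℕ, (∀ k ∈ s, CentreGoodProcrastination (r.E k) (r.D k)) → s.card ≤ B := by
  obtain ⟨n₀, hF₀⟩ := exists_hasCurveFamily (r.A 0) (r.standard 0) (hdim 0)
  obtain ⟨B, hB⟩ := ENat.ne_top_iff_exists.mp hF₀.ne_top
  refine ⟨B, fun s hs => ?_⟩
  have h := r.card_goodProcrastinations_le hdim hF₀ s hs
  rw [← hB] at h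
  exact_mod_cast h

end PermissibleRun

end CampaignW46

end Summit.ResolutionOfSingularities.ResolutionOfSingularities.Theorems

end
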